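import Summits.HodgeConjecture.HodgeConjecture.Theorems.MarkmanPartnerTransportFiniteMorphismTransport
import Literature.AlgebraicGeometry.HodgeTheory.HodgeNumbersBirationalInvariance
import Literature.AlgebraicGeometry.Surfaces.GeometricGenusOneAssociatedK3Surface

/-!
# Route MarkmanPartnerTransport · crux `PicardThreeK3Squares` (stmt-HodgeConjecture-19652) —
# programme «ISOGENY DATUM», brick 7: the total space of a roof has geometric genus one
# (`p_g` is a birational invariant — Hartshorne II 8.19 — in the `HasGeometricGenusOne` currency)

The roof theorems of `…PicardThreeK3SquaresIsogenyDatum` ask `HasGeometricGenusOne Z` for the smooth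
projective surface `Z` dominating both K3 surfaces (typically a blow-up of `Y` resolving the rational
map). This file discharges it from a BIRATIONAL MORPHISM `π : Z ⟶ Y` onto a surface of geometric genus
one with `π^*` injective on `H²` (e.g. `π` of cohomological degree `1`,
`FiniteMorphism.map_injective_of_deg`), through the tree's birational invariance of `H^{2,0}` in the
`BettiUniverse` currency (`BettiUniverse.piece_hodge_zero_eq_map_of_isBirational`, brick (PG) of the
cell, Hartshorne II Thm. 8.19) and the bridge `BettiUniverse.mem_hodge_piece_iff`:

* `hasGeometricGenusOne_of_isBirational` — **`p_g(Y) = 1 ⟹ p_g(Z) = 1`** for a birational morphism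
  `π : Z ⟶ Y` of smooth projective surfaces with `π^*` injective.

THEOREMS ONLY (no definition, no named fact, no sorry). Prover seat hodge-nonav-19652-p1 (gen 21),
`--supports stmt-HodgeConjecture-19652`. Nothing here proves an instance of the Hodge conjecture.

References: R. Hartshorne, *Algebraic Geometry*, II Thm. 8.19; C. Voisin, *Hodge Theory I* (2002),
§7.1.1 and §7.3.2; D. R. Morrison, Tokyo J. Math. 10 (1987) §1.
-/

set_option linter.dupNamespace false

noncomputable section

namespace Summit.HodgeConjecture.HodgeConjecture.Theorems.MarkmanPartnerTransport.FiniteMorphism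

open scoped TensorProduct
open Module CategoryTheory
open Literature.AlgebraicGeometry Literature.AlgebraicGeometry.Motives Literature.AlgebraicGeometry.HodgeTheory
open Literature.AlgebraicGeometry.Surfaces
open Literature.AlgebraicTopology.SingularHomology

variable {Z Y : SchemeOver ℂ}

/-- **`p_g(Y) = 1 ⟹ p_g(Z) = 1` along a birational morphism `π : Z ⟶ Y` of smooth projective surfaces
with `π^*` injective on `H²`**: the `(2,0)`-classes of `Z` are exactly the pull-backs of those of `Y`
(`BettiUniverse.piece_hodge_zero_eq_map_of_isBirational`, Hartshorne II 8.19, read on `H²(−(ℂ); ℂ)`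
through `BettiUniverse.mem_hodge_piece_iff`), so the line `ℂ ω` of `Y` pulls back to the line `ℂ π^*ω` of
`Z`. [cite: Hartshorne1977, II Thm. 8.19] [cite: VoisinHodgeI2002, §7.3.2] -/
theorem hasGeometricGenusOne_of_isBirational (hZ : IsSmoothProjective 2 Z) (hY : IsSmoothProjective 2 Y)
    (π : Z ⟶ Y) (hπ : Resolution.IsBirational π.left)
    (hinj : Function.Injective (complexBetti.map π (2 * 1))) (h1Y : HasGeometricGenusOne Y) :
    HasGeometricGenusOne Z := by
  obtain ⟨ω, hω0, hω, hline⟩ := h1Y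
  have hHD := exists_isReal_hodgeModel_holds
  have hI := hodgePQ_independent_of_hodgeModel_holds
  -- `H^{2,0}(Z) = π^* H^{2,0}(Y)` in the `BettiUniverse` currency
  have h20 := BettiUniverse.piece_hodge_zero_eq_map_of_isBirational hHD hZ hY π hπ 2
  push_cast at h20
  refine ⟨complexBetti.map π (2 * 1) ω, fun h ↦ hω0 (hinj (by rw [h, map_zero])),
    hω.map_of_isSmoothProjective hZ hY π, fun τ hτ ↦ ?_⟩
  -- read `τ` on `ℂ ⊗ H²(Z; ℚ)`
  obtain ⟨z, rfl⟩ := ofRatClassBaseChange_surjective hZ 2 τ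
  have hz : z ∈ (BettiUniverse.hodge hHD hZ 2).piece 2 0 :=
    (BettiUniverse.mem_hodge_piece_iff hHD hI hZ (add_zero 2) z).2 hτ
  rw [h20] at hz
  obtain ⟨y, hy, rfl⟩ := hz
  have hy' : IsOfHodgeType 2 Y (2 * 1) 2 0 (ofRatClassBaseChange (Motives.ComplexPoints Y) 2 y) :=
    (BettiUniverse.mem_hodge_piece_iff hHD hI hY (add_zero 2) y).1 hy
  obtain ⟨t, ht⟩ := hline _ hy'
  refine ⟨t, ?_⟩
  have hnat : complexBetti.map π 2 (ofRatClassBaseChange (Motives.ComplexPoints Y) 2 y) =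
      ofRatClassBaseChange (Motives.ComplexPoints Z) 2 ((BettiUniverse.pull π 2).baseChange ℂ y) :=
    map_ofRatClassBaseChange (Motives.ComplexPoints Y) 2 (Motives.AlgPoints.mapContinuous (L := ℂ) π) y
  change ofRatClassBaseChange (Motives.ComplexPoints Z) 2 ((BettiUniverse.pull π 2).baseChange ℂ y) = _
  rw [← hnat, ht, map_smul]

end Summit.HodgeConjecture.HodgeConjecture.Theorems.MarkmanPartnerTransport.FiniteMorphism

end
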